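import Summits.Ventures.PercRepro.GenQNearEndPiecesGenB
import Summits.Ventures.PercRepro.GenQTraceHypAddTwoB
import Summits.Ventures.PercRepro.GenQHypAddGenSharp

/-!
# PercRepro — the near end of the diagonal reduced to the SHARP profile functionals (night-4, gen 10, part D)

Part C (`GenQNearEndPiecesGenC`) used the crude functionals of `GenQHypAddGen` (coloop bound `m(B) + |Y|`); as
statements those are FALSE on the «hyperplane + 3 points» shapes (numerics, sheet §64 (r)), so part C's reductions
have unsatisfiable hypotheses there.  This part uses the sharp functionals of `GenQHypAddGenSharp` (the outside
coloops counted exactly, `m(B) + ycol M B Y`), which the numerics put far positive: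
`jq_succ_of_branch_and_functionalsS` (type layer, depth 3: BRANCH ∧ (β₂)_t ∧ `hypAddProfileS ≥ 0` on the traces
with a 3-point complement) and `traceSum_succ_of_branch_and_functionalsS` (trace layer, depth `t₀`: BRANCH ∧ the
two-point trace functional ∧ `traceHypAddProfileS ≥ 0` on the 3 … `t₀`-point complements).  At `(9, 7)` the 22
near-end cases of `HighLayersSevenResidue` / `TraceSixResidue` are exactly these with `q = 6` resp. `q = 5`.
-/
namespace PercRepro.GenQ

open Finset ThmH SixFour PerFlat Star

variable {α : Type*} [DecidableEq α] {M : Matroid α} [M.Finite]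

/-- `G = (H ∩ G) ∪ (G ∖ H)`, a disjoint union. -/
theorem inter_union_sdiff_eq' (G H : Finset α) : (H ∩ G) ∪ (G \ H) = G := by
  ext x
  simp only [Finset.mem_union, Finset.mem_inter, Finset.mem_sdiff]
  tauto

/-- **The type layer's near end at depth `3` from the branch certificate and two SHARP functionals**: (β₂)_t on the
rank-`q` sets of `n − 2` points and `hypAddProfileS ≥ 0` on every trace `H ∩ G` of a
rank-`q` flat with a three-point complement in a coloop-free rank-`(q + 1)` `n`-set. -/
theorem jq_succ_of_branch_and_functionalsS {q n t : ℕ} (hq : 1 ≤ q) (ht : t ≤ q + 1)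
    (hcert : ∀ G : Finset α, G ⊆ gr M → M.eRk (G : Set α) = ((q + 1 : ℕ) : ℕ∞) → G.card = n → mTr M G = 0 →
      (∀ H ∈ flatsQ M q, (H ∩ G).card + 3 < G.card) → 0 ≤ Jq M G (q + 1) t)
    (htwo : ∀ (τ : Finset α) (a a' : α), τ ⊆ gr M → M.eRk (τ : Set α) = (q : ℕ∞) → τ.card + 2 = n →
      a ∈ gr M → a' ∈ gr M → a ≠ a' → a ∉ τ → a' ∉ τ → a ∉ M.closure (τ : Set α) → a' ∉ M.closure (τ : Set α) →
      M.eRk ((insert a (insert a' τ) : Finset α) : Set α) = (q : ℕ∞) + 1 → 0 ≤ hypAddTwoProfile M τ a a' q t)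
    (hthreeP : ∀ (G H : Finset α), G ⊆ gr M → M.eRk (G : Set α) = ((q + 1 : ℕ) : ℕ∞) → G.card = n → mTr M G = 0 →
      H ∈ flatsQ M q → (G \ H).card = 3 → 0 ≤ hypAddProfileS M (H ∩ G) (G \ H) q t)
    (G : Finset α) (hG : G ⊆ gr M) (hrG : M.eRk (G : Set α) = ((q + 1 : ℕ) : ℕ∞)) (hcard : G.card = n)
    (hmG : mTr M G = 0) : 0 ≤ Jq M G (q + 1) t := by
  refine jq_succ_of_three_pieces_depth3_type hq ht hcert htwo ?_ G hG hrG hcard hmG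
  intro G' H hG' hrG' hcard' hmG' hH h3
  have hdisj : Disjoint (H ∩ G') (G' \ H) := by
    rw [Finset.disjoint_left]
    intro x hx hx'
    exact (Finset.mem_sdiff.1 hx').2 (Finset.mem_inter.1 hx).1
  have key := Jq_hyp_add_ge_profileS (M := M) (τ := H ∩ G') (X := G' \ H) (q := q) (t := t) hdisj
    (Finset.sdiff_subset.trans hG') ht
  rw [inter_union_sdiff_eq'] at key
  exact le_trans (hthreeP G' H hG' hrG' hcard' hmG' hH h3) key

/-- **The trace layer's near end at depth `t₀` from the branch certificate and two SHARP functionals**: the exact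
two-point trace functional on the rank-`q` sets of `n − 2` points and `traceHypAddProfileS ≥ 0` on every trace
`H ∩ G` of a rank-`q` flat with a complement of `3 … t₀` points in a coloop-free rank-`(q + 1)` `n`-set. -/
theorem traceSum_succ_of_branch_and_functionalsS {q n t t₀ : ℕ} (hq : 1 ≤ q) (ht : t ≤ q + 2)
    (hcert : ∀ G : Finset α, G ⊆ gr M → M.eRk (G : Set α) = ((q + 1 : ℕ) : ℕ∞) → G.card = n → mTr M G = 0 →
      (∀ H ∈ flatsQ M q, (H ∩ G).card + t₀ < G.card) →
      0 ≤ ∑ B ∈ Rq M G (q + 1), ((((q + 1 + 1 : ℕ) : ℚ) + 2 - t) * (1 / (2 + (mTr M B : ℚ))) -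
        ((((q + 1 + 1 : ℕ) : ℚ) + 2) / (((q + 1 + 1 : ℕ) : ℚ) + 1)) * dem M G t B))
    (htwo : ∀ (τ : Finset α) (a a' : α), τ ⊆ gr M → M.eRk (τ : Set α) = (q : ℕ∞) → τ.card + 2 = n →
      a ∈ gr M → a' ∈ gr M → a ≠ a' → a ∉ τ → a' ∉ τ → a ∉ M.closure (τ : Set α) → a' ∉ M.closure (τ : Set α) →
      M.eRk ((insert a (insert a' τ) : Finset α) : Set α) = (q : ℕ∞) + 1 → 0 ≤ traceHypAddTwoProfile M τ a a' q t)
    (hshapeP : ∀ (G H : Finset α), G ⊆ gr M → M.eRk (G : Set α) = ((q + 1 : ℕ) : ℕ∞) → G.card = n → mTr M G = 0 →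
      H ∈ flatsQ M q → 3 ≤ (G \ H).card → (G \ H).card ≤ t₀ → 0 ≤ traceHypAddProfileS M (H ∩ G) (G \ H) q t)
    (G : Finset α) (hG : G ⊆ gr M) (hrG : M.eRk (G : Set α) = ((q + 1 : ℕ) : ℕ∞)) (hcard : G.card = n)
    (hmG : mTr M G = 0) :
    0 ≤ ∑ B ∈ Rq M G (q + 1), ((((q + 1 + 1 : ℕ) : ℚ) + 2 - t) * (1 / (2 + (mTr M B : ℚ))) -
      ((((q + 1 + 1 : ℕ) : ℚ) + 2) / (((q + 1 + 1 : ℕ) : ℚ) + 1)) * dem M G t B) := by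
  refine traceSum_succ_of_branch_functional_and_shapes hq ht hcert htwo ?_ G hG hrG hcard hmG
  intro G' H hG' hrG' hcard' hmG' hH h3 ht0
  have hdisj : Disjoint (H ∩ G') (G' \ H) := by
    rw [Finset.disjoint_left]
    intro x hx hx'
    exact (Finset.mem_sdiff.1 hx').2 (Finset.mem_inter.1 hx).1
  have key := traceSum_hyp_add_ge_profileS (M := M) (τ := H ∩ G') (X := G' \ H) (q := q) (t := t) hdisj
    (Finset.sdiff_subset.trans hG') ht
  rw [inter_union_sdiff_eq'] at key
  exact le_trans (hshapeP G' H hG' hrG' hcard' hmG' hH h3 ht0) key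

end PercRepro.GenQ
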